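import Literature.Analysis.FluidPDE.SobolevWholeSpace
import Literature.Analysis.FluidPDE.CKNTenThirdsInterpolation
import HarnessLib

/-!
# The parabolic `L^{10/3}` interpolation from slice bounds (Sobolev step of Moser's iteration)

Analysis/FluidPDE proofs file (theorems only), on the discharge path of the named fact
`Literature.Analysis.FluidPDE.LeiZhang2011_liouville` (Z. Lei, Q. S. Zhang, J. Funct. Anal. 261
(2011) = arXiv:1011.5066). The first display of the Moser step on p. 7:
"By Hölder inequality and Sobolev imbedding theorem, one has
`∬ (ψ_R f)^{10/3} ≲ ∫ (‖fψ_R(·,s)‖_{L²}^{4/3} ‖∇(fψ_R)‖²_{L²}) ds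
 ≲ sup_s ‖fψ_R(·,s)‖_{L²}^{4/3} ‖∇(fψ_R)‖²_{L²(P)}`",
for a scalar space–time function `g` whose slices are `C¹` with `‖g(s)‖_{L²}² ≤ M*` and
`‖∇g(s)‖_{L²}² ≤ W(s)`:

`∬ |g|^{10/3} ≤ C_S² · M*^{2/3} · ∫ W(s) ds`

(`lintegral_rpow_tenThirds_le_of_slice_bounds`, in `ℝ≥0∞` form, any `s`-finite measure in
time), from the slice interpolation `∫ f^{10/3} ≤ (∫ f²)^{2/3}(∫ f⁶)^{1/3}`
(`lintegral_rpow_tenThirds_le_Lp_interpolation`) and the Sobolev inequality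
`‖u‖_{L⁶(ℝ³)} ≤ C_S ‖∇u‖_{L²(ℝ³)}` (`eLpNorm_six_le_eLpNorm_fderiv_two`).

## References

* Z. Lei, Q. S. Zhang, J. Funct. Anal. 261 (2011) = arXiv:1011.5066, §2, p. 7, first display of
  the Moser step. [LeiZhang2011]
-/

noncomputable section

open MeasureTheory Set Function Filter
open scoped NNReal ENNReal

namespace Literature.Analysis.FluidPDE

namespace LeiZhang2011

/-- `(∫ ‖u‖ₑ⁶)^{1/3} = ‖u‖_{L⁶}²`. [folklore] -/
theorem lintegral_enorm_rpow_six_rpow_third {α : Type*} [MeasurableSpace α] (μ : Measure α)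
    (u : α → ℝ) : (∫⁻ x, ‖u x‖ₑ ^ (6 : ℝ) ∂μ) ^ (1 / 3 : ℝ) = eLpNorm u 6 μ ^ 2 := by
  rw [eLpNorm_eq_lintegral_rpow_enorm_toReal (by norm_num) (by norm_num)]
  simp only [ENNReal.toReal_ofNat]
  rw [← ENNReal.rpow_natCast, ← ENNReal.rpow_mul]
  norm_num

/-- `‖v‖_{L²}² = ∫ ‖v‖ₑ²`. [folklore] -/
theorem eLpNorm_two_sq_eq_lintegral {α F : Type*} [MeasurableSpace α] [NormedAddCommGroup F]
    (μ : Measure α) (v : α → F) : eLpNorm v 2 μ ^ 2 = ∫⁻ x, ‖v x‖ₑ ^ 2 ∂μ := by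
  rw [eLpNorm_eq_lintegral_rpow_enorm_toReal (by norm_num) (by norm_num)]
  simp only [ENNReal.toReal_ofNat]
  rw [← ENNReal.rpow_natCast, ← ENNReal.rpow_mul]
  norm_num

/-- **The Sobolev step of Moser's iteration** (Lei–Zhang 2011, p. 7, first display): for a
space–time scalar function `g` on `ℝ × ℝ³` whose slices `g(s,·)` are `C¹` with
`‖g(s)‖_{L²} < ∞`, `∫ ‖g(s)‖ₑ² ≤ M*` and `∫ ‖∇g(s)‖ₑ² ≤ W(s)` for `ν`-a.e. `s`
(`W` a.e.-measurable),
`∬ ‖g‖ₑ^{10/3} d(ν ⊗ dx) ≤ C_S² · M*^{2/3} · ∫ W dν`, `C_S` the Sobolev constant of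
`H¹(ℝ³) ⊂ L⁶(ℝ³)`. [cite: LeiZhang2011, §2 (arXiv p. 7), Sobolev step of the Moser iteration] -/
theorem lintegral_rpow_tenThirds_le_of_slice_bounds
    {g : ℝ → EuclideanSpace ℝ (Fin 3) → ℝ} {ν : Measure ℝ}
    (hg : ∀ᵐ s ∂ν, ContDiff ℝ 1 (g s))
    (hg2 : ∀ᵐ s ∂ν, eLpNorm (g s) 2 (volume : Measure (EuclideanSpace ℝ (Fin 3))) < ∞)
    {Mstar : ℝ≥0∞} (hM : ∀ᵐ s ∂ν, ∫⁻ x, ‖g s x‖ₑ ^ 2 ≤ Mstar)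
    {W : ℝ → ℝ≥0∞} (hWm : AEMeasurable W ν)
    (hW : ∀ᵐ s ∂ν, ∫⁻ x, ‖fderiv ℝ (g s) x‖ₑ ^ 2 ≤ W s) :
    ∫⁻ p, ‖g p.1 p.2‖ₑ ^ (10 / 3 : ℝ) ∂(ν.prod volume) ≤
      (SNormLESNormFDerivOfEqConst ℝ (volume : Measure (EuclideanSpace ℝ (Fin 3))) 2 : ℝ≥0∞) ^ 2 *
        Mstar ^ (2 / 3 : ℝ) * ∫⁻ s, W s ∂ν := by
  set CS : ℝ≥0∞ := (SNormLESNormFDerivOfEqConst ℝ (volume : Measure (EuclideanSpace ℝ (Fin 3))) 2 :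
    ℝ≥0∞) with hCS
  have hE : Module.finrank ℝ (EuclideanSpace ℝ (Fin 3)) = 3 := by simp
  -- Tonelli (the inequality direction needs no measurability)
  refine (lintegral_prod_le _).trans ?_
  -- slice bound
  have hslice : ∀ᵐ s ∂ν, ∫⁻ x, ‖g s x‖ₑ ^ (10 / 3 : ℝ) ≤ CS ^ 2 * Mstar ^ (2 / 3 : ℝ) * W s := by
    filter_upwards [hg, hg2, hM, hW] with s hgs hg2s hMs hWs
    have hmeas : AEMeasurable (fun x => ‖g s x‖ₑ) (volume : Measure (EuclideanSpace ℝ (Fin 3))) :=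
      hgs.continuous.measurable.enorm.aemeasurable
    have h1 := lintegral_rpow_tenThirds_le_Lp_interpolation volume hmeas
    have h2 : (∫⁻ x, ‖g s x‖ₑ ^ (2 : ℕ)) ^ (2 / 3 : ℝ) ≤ Mstar ^ (2 / 3 : ℝ) :=
      ENNReal.rpow_le_rpow hMs (by norm_num)
    have h3 : (∫⁻ x, ‖g s x‖ₑ ^ (6 : ℝ)) ^ (1 / 3 : ℝ) ≤ CS ^ 2 * W s := by
      rw [lintegral_enorm_rpow_six_rpow_third]
      have hsob := eLpNorm_six_le_eLpNorm_fderiv_two volume hE hgs hg2s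
      calc eLpNorm (g s) 6 volume ^ 2
          ≤ (CS * eLpNorm (fderiv ℝ (g s)) 2 volume) ^ 2 := pow_le_pow_left' hsob 2
        _ = CS ^ 2 * ∫⁻ x, ‖fderiv ℝ (g s) x‖ₑ ^ 2 := by
            rw [mul_pow, eLpNorm_two_sq_eq_lintegral]
        _ ≤ CS ^ 2 * W s := mul_le_mul_right hWs _
    calc ∫⁻ x, ‖g s x‖ₑ ^ (10 / 3 : ℝ)
        ≤ (∫⁻ x, ‖g s x‖ₑ ^ (2 : ℕ)) ^ (2 / 3 : ℝ) * (∫⁻ x, ‖g s x‖ₑ ^ (6 : ℝ)) ^ (1 / 3 : ℝ) := h1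
      _ ≤ Mstar ^ (2 / 3 : ℝ) * (CS ^ 2 * W s) := mul_le_mul' h2 h3
      _ = CS ^ 2 * Mstar ^ (2 / 3 : ℝ) * W s := by ring
  calc ∫⁻ s, ∫⁻ x, ‖g (s, x).1 (s, x).2‖ₑ ^ (10 / 3 : ℝ) ∂volume ∂ν
      ≤ ∫⁻ s, CS ^ 2 * Mstar ^ (2 / 3 : ℝ) * W s ∂ν := lintegral_mono_ae hslice
    _ = CS ^ 2 * Mstar ^ (2 / 3 : ℝ) * ∫⁻ s, W s ∂ν := lintegral_const_mul'' _ hWm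

end LeiZhang2011

end Literature.Analysis.FluidPDE
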